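import Summits.QuantumFields.YangMills.Theses.TransportPerturbation
import Summits.QuantumFields.YangMills.Theorems.ColdStartUniversalityUniformColdStartMixingDictionary

/-!
# Route `TransportPerturbation` — support `GibbsInvariance` (stmt-QuantumFields-26921) FROM the named fact
# `WilsonMeasureLangevinInvariant` (SZZ Lemma 3.3) read through the bond dictionary

Seat `ym-line-sfw-p1` g12 (2026-08-28).  Rung R3 is a RECORD-label rung (leaf `YM3TorusSU2`), not the Clay mass gap; this module is
measure-theoretic bookkeeping and proves no step of any renormalisation-group argument.

`GibbsInvariance` asks: for every family `F`, `γ > 0`, step `K` and every jointly measurable family `V` of strong solutions of the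
step-`K` SZZ lattice Langevin dynamics (`SU(2)`, fundamental representation, inverse coupling `(γ ε_K)⁻¹/2`), Bałaban's step-`K` Gibbs law
`gibbsMeasure (F.P K) (γ ε_K)⁻¹` is invariant under the transition operators `P_t` on bounded measurable `g` (read through the bond
dictionary `b ↦ (b.src, b.dir)`).  THIS FILE: the CONDITIONAL closure the planner asked for (`…_of_invariant`):
`gibbsInvariance_of_wilsonInvariant : (∀ L β, WilsonMeasureLangevinInvariant r 3 L β) → GibbsInvariance`, `r` = `SU(2)` fundamental —
Bałaban's expectation is the host Wilson measure `wilsonMeasure (fundamentalRep (Fin 2)) (β/2)` along the dictionary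
(`T4GenFunBounds.integral_gibbsMeasure_eq_expect` + `ColdStartUniversality.expect_eq_integral_wilsonMeasure`), the scope hypothesis
`r.IsClassicalDefining` is the tree's `LatticeRep.isClassicalDefining_specialUnitaryGroup 2`, and `(e ↦ V (e.1, e.2)) = V`.
The named fact itself (invariance of the lattice Yang–Mills measure under (⋆), [ShenZhuZhu2022] Lemma 3.3: Itô's formula + symmetry of
the generator in `L²(μ)`) is NOT proved here, so this is a `conditional-result` and does not close the item.  No definitions, no `sorry`.
-/

set_option autoImplicit false

noncomputable section

open MeasureTheory
open Literature.MathematicalPhysics.QuantumFieldTheory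
open Literature.MathematicalPhysics.QuantumFieldTheory.Balaban1983to89
open Literature.MathematicalPhysics.QuantumLattice (fundamentalRep continuous_fundamentalRep fundamentalRep_injective
  fundamentalRep_mem_unitaryGroup)

namespace Summit.QuantumFields.YangMills.Theorems.TransportPerturbation

/-- **The bond dictionary for Bałaban's step-`K` Gibbs law, `SU(2)`, `d = 3`**: for `β ≥ 0` and every `g` on tree configurations,
`∫ g(e ↦ U⟨e.1,e.2⟩) d(gibbsMeasure (F.P K) β)(U) = ∫ g d(wilsonMeasure (fundamentalRep (Fin 2)) (β/2))`. [cite: Balaban1985UV3, (1)-(2) p.256] -/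
theorem integral_gibbsMeasure_toConfig_eq_integral_wilsonMeasure (F : T3ContinuumYM3Torus.T3Family) (K : ℕ) {β : ℝ} (hβ : 0 ≤ β)
    (g : GaugeConfig 3 ((F.P K).sitesPerDir 0) (Matrix.specialUnitaryGroup (Fin 2) ℂ) → ℝ) :
    ∫ U, g (fun e => U ⟨e.1, e.2⟩) ∂(T4GenFunBounds.gibbsMeasure (G := Matrix.specialUnitaryGroup (Fin 2) ℂ) (F.P K) β) =
      ∫ V, g V ∂(wilsonMeasure (d := 3) (L := (F.P K).sitesPerDir 0) (fundamentalRep (Fin 2)) (β / 2)) := by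
  rw [T4GenFunBounds.integral_gibbsMeasure_eq_expect (F.P K) hβ,
    ColdStartUniversality.expect_eq_integral_wilsonMeasure (F.P K) β]
  refine integral_congr_ae (ae_of_all _ fun V => ?_)
  simp only [Prod.mk.eta]

/-- ★ **`GibbsInvariance` from the named fact `WilsonMeasureLangevinInvariant`** (SZZ Lemma 3.3 for `SU(2)` in its fundamental
representation, every torus size `L` and every inverse coupling `β`): CONDITIONAL closure of stmt-QuantumFields-26921 — the Gibbs law of
record is the Wilson measure at `β_K/2` along the bond dictionary, the scope hypothesis `IsClassicalDefining` holds for `SU(2)`, and the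
solution family / bounded measurable observable are handed over verbatim. [cite: ShenZhuZhu2022, §3 Lemma 3.3 (p. 13)] -/
theorem gibbsInvariance_of_wilsonInvariant
    (hW : ∀ (L : ℕ) [NeZero L] (β : ℝ),
      WilsonMeasureLangevinInvariant (G := Matrix.specialUnitaryGroup (Fin 2) ℂ)
        (⟨2, fundamentalRep (Fin 2), continuous_fundamentalRep _, fundamentalRep_injective _, fundamentalRep_mem_unitaryGroup⟩ :
          LatticeRep (Matrix.specialUnitaryGroup (Fin 2) ℂ)) 3 L β) :
    Summit.QuantumFields.YangMills.Theses.TransportPerturbation.GibbsInvariance := by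
  intro F γ hγ K Ω mΩ P hP W hBM V hV g hgm hg1 t
  have hβ : 0 ≤ (F.scheme (ExpMeanLog.expMeanLogSU : LoopAverage (Matrix.specialUnitaryGroup (Fin 2) ℂ)) γ).β K :=
    F.scheme_β_nonneg _ hγ.le K
  have h1 := integral_gibbsMeasure_toConfig_eq_integral_wilsonMeasure F K hβ (markovTransition V P t g)
  have h2 := integral_gibbsMeasure_toConfig_eq_integral_wilsonMeasure F K hβ g
  have hscope := LatticeRep.isClassicalDefining_specialUnitaryGroup 2
  have hmid := hW ((F.P K).sitesPerDir 0) ((γ * (F.P K).eps)⁻¹ / 2) hscope Ω P W hBM V hV.1 g hgm ⟨1, hg1⟩ t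
  exact h1.trans (hmid.trans h2.symm)

end Summit.QuantumFields.YangMills.Theorems.TransportPerturbation

end
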